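import Literature.MathematicalPhysics.QuantumLattice.HubbardGridTadpoleFlow
import Literature.MathematicalPhysics.QuantumLattice.HubbardGridCounterQuadratic
import Literature.MathematicalPhysics.QuantumLattice.HubbardGridInteractionKernels
import HarnessLib

/-!
# The pinned `ℓ¹` norms of the tracked local part `uV₁ + νN₂` on the time grid

Topic `MathematicalPhysics/QuantumLattice`; the hypothesis `hNL` of `GrassmannFlowDB(Refined).iterEffAction_splitFlow_…` for the Hubbard
torus on the grid (cell gate-hubbard-kl, R0-SCOPE-4 W6).  The local quartic `V₁ = (β/N) Σ_q ψ⁺↑ψ⁻↑ψ⁺↓ψ⁻↓(q)` has pinned kernel sums `≤ β/N`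
(`HubbardGridInteractionKernels`, a pinned leg fixes the point); the local quadratic `N₂ = (β/N) Σ_{q,σ} ψ⁺_{qσ}ψ⁻_{qσ}` is a structured quadratic in the sense of
`HubbardGridCounterQuadratic.sum_norm_kernel_two_structured_le`.  Hence (Salmhofer 1998/1999 `L¹–L^∞` norms; the antisymmetrisation never
costs a factorial, `kernelNorm_kernel_presented_le`):

* (the quartic half is `HubbardGridInteractionKernels.sum_norm_kernel_hubbardGridInteraction_le`, `…_of_ne`);
* `sum_norm_kernel_hubbardGridQuadratic_le` — `Σ_{Y : Y_p = w} ‖kernel N₂ 2 Y‖ ≤ β/N`, `kernel_hubbardGridQuadratic_of_ne`;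
* **`sum_norm_kernel_gridTracked_le`** — `Σ_{Y : Y_p = w} ‖kernel (uV₁ + νN₂) m Y‖ ≤ gridTrackedNL β u ν m`
  (`‖u‖β/N` in degree `4`, `‖ν‖β/N` in degree `2`, `0` otherwise).

Everything is proved; `gridTrackedNL` is the only definition; no named facts.

## Sources

M. Salmhofer, *Renormalization* (1999), §4.3 (4.95) and Comm. Math. Phys. 194 (1998) §4.1 (`Salmhofer1999`, `Salmhofer1998`);
G. Benfatto, A. Giuliani, V. Mastropietro, Ann. Henri Poincaré 7 (2006) 809–898, (2.86)–(2.88) (`BenfattoGiulianiMastropietro2006`).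
-/

noncomputable section

namespace Literature.MathematicalPhysics.QuantumLattice

open Literature.Probability.LatticeModels GrassmannAlgebra Finset

variable {L N : ℕ} [NeZero L]

/-! ### The quadratic as a structured quadratic -/

/-- `N₂` as a structured quadratic over `(point, spin)`. [cite: Salmhofer1999, §4.2.4 (4.58)] -/
theorem hubbardGridQuadratic_eq_sum (β : ℝ) :
    hubbardGridQuadratic L N β = ∑ i ∈ (univ : Finset (GridPoint L N × Fin 2)),
      (((β / N) : ℝ) : ℂ) • (gen ℂ (((i.1, i.2), 0) : GridLeg (GridPoint L N)) * gen ℂ (((i.1, i.2), 1) : GridLeg (GridPoint L N))) := by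
  simp only [hubbardGridQuadratic, Finset.smul_sum, Fintype.sum_prod_type]

/-- **The pinned `ℓ¹` norms of the local quadratic**: `Σ_{Y : Y_p = w} ‖kernel N₂ 2 Y‖ ≤ β/N` (`β ≥ 0`). [cite: Salmhofer1999, §4.3 (4.95)] -/
theorem sum_norm_kernel_hubbardGridQuadratic_le {β : ℝ} (hβ : 0 ≤ β) (p : Fin 2) (w : GridLeg (GridPoint L N)) :
    ∑ Y ∈ univ.filter (fun Y : Fin 2 → GridLeg (GridPoint L N) => Y p = w), ‖kernel ℂ (hubbardGridQuadratic L N β) 2 Y‖ ≤ β / N := by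
  classical
  rw [hubbardGridQuadratic_eq_sum]
  have hc : ‖(((β / N) : ℝ) : ℂ)‖ = β / N := by rw [Complex.norm_real, Real.norm_eq_abs, abs_of_nonneg (by positivity)]
  have hone : ∀ (c : Fin 2) (w : GridLeg (GridPoint L N)),
      ∑ i ∈ (univ : Finset (GridPoint L N × Fin 2)).filter (fun i => (((i.1, i.2), c) : GridLeg (GridPoint L N)) = w),
        ‖(((β / N) : ℝ) : ℂ)‖ ≤ β / N := by
    intro c w
    rw [sum_const, nsmul_eq_mul, hc]
    have hcard : ((univ : Finset (GridPoint L N × Fin 2)).filter (fun i => (((i.1, i.2), c) : GridLeg (GridPoint L N)) = w)).card ≤ 1 := by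
      refine card_le_one.2 fun i hi j hj => ?_
      have h1 := (mem_filter.1 hi).2
      have h2 := (mem_filter.1 hj).2
      have := h1.trans h2.symm
      simp only [Prod.mk.injEq] at this
      exact Prod.ext this.1.1 this.1.2
    calc (((univ : Finset (GridPoint L N × Fin 2)).filter (fun i => (((i.1, i.2), c) : GridLeg (GridPoint L N)) = w)).card : ℝ) * (β / N)
        ≤ 1 * (β / N) := mul_le_mul_of_nonneg_right (by exact_mod_cast hcard) (by positivity)
      _ = β / N := one_mul _
  exact sum_norm_kernel_two_structured_le _ _ _ _ (hone 0) (hone 1) p w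

/-- The local quadratic has kernels only in degree `2`. [cite: Salmhofer1999, §4.3 (4.95)] -/
theorem kernel_hubbardGridQuadratic_of_ne (β : ℝ) {m : ℕ} (hm : m ≠ 2) (Y : Fin m → GridLeg (GridPoint L N)) :
    kernel ℂ (hubbardGridQuadratic L N β) m Y = 0 := by
  rw [hubbardGridQuadratic, kernel_smul, kernel_sum]
  rw [sum_eq_zero fun q _ => ?_, mul_zero]
  rw [kernel_sum]
  refine sum_eq_zero fun σ _ => ?_
  rw [show gen ℂ (((q, σ), 0) : GridLeg (GridPoint L N)) * gen ℂ (((q, σ), 1) : GridLeg (GridPoint L N)) =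
      genProd ℂ ![(((q, σ), 0) : GridLeg (GridPoint L N)), ((q, σ), 1)] by
    rw [genProd_succ, genProd_succ, genProd_zero, mul_one]; rfl, kernel_genProd_of_ne _ _ _ hm]

/-! ### The tracked family -/

variable (N) in
/-- The **pinned-norm majorant of the tracked part**: `‖u‖β/N` in degree `4`, `‖ν‖β/N` in degree `2`, `0` otherwise.
[cite: BenfattoGiulianiMastropietro2006, (2.86)-(2.88)] -/
def gridTrackedNL (β : ℝ) (u ν : ℂ) (m : ℕ) : ℝ := if m = 4 then ‖u‖ * (β / N) else if m = 2 then ‖ν‖ * (β / N) else 0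

omit [NeZero L] in
/-- The majorant is nonnegative for `β ≥ 0`. [cite: BenfattoGiulianiMastropietro2006, (2.86)-(2.88)] -/
theorem gridTrackedNL_nonneg {β : ℝ} (hβ : 0 ≤ β) (u ν : ℂ) (m : ℕ) : 0 ≤ gridTrackedNL N β u ν m := by
  unfold gridTrackedNL; split_ifs <;> positivity

/-- **The pinned `ℓ¹` norms of the tracked part** `uV₁ + νN₂`: `Σ_{Y : Y_p = w} ‖kernel (uV₁+νN₂) m Y‖ ≤ gridTrackedNL β u ν m`
for every degree `m`, slot `p` and leg `w` (`β ≥ 0`). [cite: BenfattoGiulianiMastropietro2006, (2.86)-(2.88)] -/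
theorem sum_norm_kernel_gridTracked_le [NeZero N] {β : ℝ} (hβ : 0 ≤ β) (u ν : ℂ) (m : ℕ) (p : Fin m) (w : GridLeg (GridPoint L N)) :
    ∑ Y ∈ univ.filter (fun Y : Fin m → GridLeg (GridPoint L N) => Y p = w), ‖kernel ℂ (gridTracked L N β u ν) m Y‖ ≤
      gridTrackedNL N β u ν m := by
  classical
  have hsplit : ∀ Y : Fin m → GridLeg (GridPoint L N), ‖kernel ℂ (gridTracked L N β u ν) m Y‖ ≤
      ‖u‖ * ‖kernel ℂ (hubbardGridInteraction L N β 1) m Y‖ + ‖ν‖ * ‖kernel ℂ (hubbardGridQuadratic L N β) m Y‖ := by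
    intro Y
    rw [gridTracked, kernel_add, kernel_smul, kernel_smul]
    exact (norm_add_le _ _).trans (by rw [norm_mul, norm_mul])
  refine (sum_le_sum fun Y _ => hsplit Y).trans ?_
  rw [sum_add_distrib, ← mul_sum, ← mul_sum]
  unfold gridTrackedNL
  by_cases h4 : m = 4
  · subst h4
    rw [if_pos rfl]
    have h2 : ∑ Y ∈ univ.filter (fun Y : Fin 4 → GridLeg (GridPoint L N) => Y p = w), ‖kernel ℂ (hubbardGridQuadratic L N β) 4 Y‖ = 0 :=
      sum_eq_zero fun Y _ => by rw [kernel_hubbardGridQuadratic_of_ne β (by norm_num), norm_zero]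
    rw [h2, mul_zero, add_zero]
    refine mul_le_mul_of_nonneg_left ((sum_norm_kernel_hubbardGridInteraction_le β 1 p w).trans (le_of_eq ?_)) (norm_nonneg _)
    rw [abs_one, one_mul, abs_of_nonneg hβ]
  · rw [if_neg h4]
    have h1 : ∑ Y ∈ univ.filter (fun Y : Fin m → GridLeg (GridPoint L N) => Y p = w), ‖kernel ℂ (hubbardGridInteraction L N β 1) m Y‖ = 0 :=
      sum_eq_zero fun Y _ => by rw [kernel_hubbardGridInteraction_of_ne β 1 h4, norm_zero]
    rw [h1, mul_zero, zero_add]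
    by_cases h2 : m = 2
    · subst h2
      rw [if_pos rfl]
      exact mul_le_mul_of_nonneg_left (sum_norm_kernel_hubbardGridQuadratic_le hβ p w) (norm_nonneg _)
    · rw [if_neg h2]
      have h3 : ∑ Y ∈ univ.filter (fun Y : Fin m → GridLeg (GridPoint L N) => Y p = w), ‖kernel ℂ (hubbardGridQuadratic L N β) m Y‖ = 0 :=
        sum_eq_zero fun Y _ => by rw [kernel_hubbardGridQuadratic_of_ne β h2, norm_zero]
      rw [h3, mul_zero]

end Literature.MathematicalPhysics.QuantumLattice

end
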